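import Summits.FinalStateConjecture.FinalStateConjecture.Statement
import Literature.Geometry.Lorentzian.TameGenericityDiagonal
import Literature.Geometry.Lorentzian.TameGenericityLocal
import HarnessLib

/-!
# `CaptureSufficesTame` (stmt-FinalStateConjecture-17270, route PhaseMixingCapture, rank 6),
# line `SketchIdeator2` (card `only-the-third-law-is-generic`): the KICK reduction

The crux is the conditional `NearExtremalKappaCapture → BulkKerrCaptureC2 → WeakCosmicCensorshipTame →
FinalStateConjecture`; under the tame re-typing of the summit (T2, p126844) its first two hypotheses are
idle and the third — TAME weak cosmic censorship in MGHD form — is the source of censored base curves.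
This file is the REDUCTION THEOREM of the line (playbook: reduction first, hypotheses = the registered
stub texts verbatim), sorry-free and definition-free, and deliberately `Theses`-free (it concludes the
summit `FinalStateConjecture` by name; the crux then follows by `fun _ _ hW ↦ …` in the skeleton):

* `isTameChristodoulouGeneric_of_relativeKick` — the composition of tame Christodoulou genericities
  along curves (`InitialDataSet.isTameChristodoulouGeneric_of_relative'`, TameGenericityDiagonal.lean)
  in KICK form: the relative witness is owed only along base curves whose base datum FAILS the target
  property (the composition never calls it elsewhere — the base datum is an exceptional datum), and only
  LOCALLY in the parameter (good members for `0 < ‖c‖ < ε`; `isTameChristodoulouGeneric_of_local`,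
  TameGenericityLocal.lean). No self-witness half is owed.
* `finalStateConjecture_of_thirdLawKick` — the re-typed summit from: (W) tame weak cosmic censorship
  (VERBATIM the body of the crux's hypothesis `WeakCosmicCensorshipTame`); (A) pointwise C⁰ attraction
  of censored MGHDs (VERBATIM item stmt-17296 `GlobalAttraction.CensoredExteriorsSettle`, the line's
  `stub_censoredExteriorsSettleC0`); (U) pointwise C⁰ → C² upgrade at sub-extremal endpoints (VERBATIM
  item stmt-17298 `GlobalAttraction.SubextremalUpgrade`, the line's `stub_subextremalUpgrade`); (R) the
  third law along censored tame curves in local kick form (the line's `stub_thirdLawKick`).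

* `finalStateConjecture_of_unparkingKick` (v2) — the same with the kick's matrix weakened to its ∃-form
  (UN-PARKED: whenever an MGHD carries some honest C⁰ endpoint configuration it carries one with sub-extremal
  labels), immune to the open C⁰-label-rigidity question; the line's registered `stub_unparkingKick`.

Nothing here is analysis: (A), (U), (R) carry the dynamical content (attraction to the closed Kerr
family, red-shift upgrade, genericity of the third law along censored curves).
-/

set_option linter.dupNamespace false

noncomputable section

open scoped Manifold ContDiff Topology ENNReal
open Set Function Filter

namespace Summit.FinalStateConjecture.FinalStateConjecture.Theorems.PhaseMixingCaptureCaptureSufficesTame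

open Literature.Geometry.Lorentzian
open Summit.FinalStateConjecture (HasCompleteNullInfinity exteriorOf RaysStayInClosure HasExhaustiveCharts
  IsFutureOriented)

section Composition

variable {X : Type} [TopologicalSpace X] [ChartedSpace E3 X] [IsManifold (𝓡 3) ∞ X]

/-- **Composition of tame Christodoulou genericities along curves, KICK form.** Let every datum of `𝓓`
have a sole, strongly asymptotically flat end, let `Q` be tame-generic in `𝓓` with codimension `1`, and
suppose: for every end `e` and every tame curve `F` of `𝓓`-data on `e` with `Q`-members off `0` (`F` told
immersed-injective, or constant) whose base datum FAILS `P`, there are an end `e'`, a tame injective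
immersed curve `F'` of `𝓓`-data through `F 0` and an `ε > 0` such that the members with `0 < ‖c‖ < ε`
satisfy `P`. Then `P` is tame-generic in `𝓓` with codimension `1`. (The `hrel` of
`isTameChristodoulouGeneric_of_relative'` restricted to exceptional base data and localised in the
parameter.) [folklore] -/
theorem isTameChristodoulouGeneric_of_relativeKick {𝓓 : Set (InitialDataSet (𝓡 3) X)}
    {Q P : InitialDataSet (𝓡 3) X → Prop}
    (h𝓓 : ∀ d ∈ 𝓓, ∃ e : AFEnd X, e.IsSoleEnd ∧ ∃ M : ℝ, e.IsStronglyAsymptoticallyFlatDR d M)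
    (hQ : InitialDataSet.IsTameChristodoulouGeneric 𝓓 Q 1)
    (hkick : ∀ (e : AFEnd X) (F : EuclideanSpace ℝ (Fin 1) → InitialDataSet (𝓡 3) X),
      InitialDataSet.IsTameDataFamily e 1 F →
        ((InitialDataSet.IsImmersedAtZero 1 F ∧ Injective F) ∨ ∀ c, F c = F 0) →
        (∀ c, F c ∈ 𝓓) → (∀ c ≠ 0, Q (F c)) → ¬ P (F 0) →
          ∃ (e' : AFEnd X) (F' : EuclideanSpace ℝ (Fin 1) → InitialDataSet (𝓡 3) X),
            InitialDataSet.IsTameDataFamily e' 1 F' ∧ F' 0 = F 0 ∧ Injective F' ∧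
              InitialDataSet.IsImmersedAtZero 1 F' ∧ (∀ c, F' c ∈ 𝓓) ∧
              ∃ ε > (0 : ℝ), ∀ c, c ≠ 0 → ‖c‖ < ε → P (F' c)) :
    InitialDataSet.IsTameChristodoulouGeneric 𝓓 P 1 := by
  refine InitialDataSet.isTameChristodoulouGeneric_of_local fun d hd𝓓 hdP ↦ ?_
  -- the tame base curve through `d`: constant if `Q d`, the `Q`-witness otherwise
  have base : ∃ (e : AFEnd X) (F : EuclideanSpace ℝ (Fin 1) → InitialDataSet (𝓡 3) X),
      InitialDataSet.IsTameDataFamily e 1 F ∧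
        ((InitialDataSet.IsImmersedAtZero 1 F ∧ Injective F) ∨ ∀ c, F c = F 0) ∧
        F 0 = d ∧ (∀ c, F c ∈ 𝓓) ∧ ∀ c ≠ 0, Q (F c) := by
    by_cases hQd : Q d
    · obtain ⟨e, hsole, M, hSAF⟩ := h𝓓 d hd𝓓
      exact ⟨e, fun _ ↦ d, InitialDataSet.isTameDataFamily_const hsole 1 hSAF, Or.inr fun _ ↦ rfl, rfl,
        fun _ ↦ hd𝓓, fun _ _ ↦ hQd⟩
    · obtain ⟨e, F, hF, himmF, h0, hinjF, h𝓓F, hE⟩ := hQ d ⟨hd𝓓, hQd⟩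
      refine ⟨e, F, hF, Or.inl ⟨himmF, hinjF⟩, h0, h𝓓F, fun c hc ↦ ?_⟩
      by_contra hQc
      exact hE c hc ⟨h𝓓F c, hQc⟩
  obtain ⟨e, F, hF, hFdich, hF0, hF𝓓, hFQ⟩ := base
  obtain ⟨e', F', hF', hF'0, hinj, himm, hF'𝓓, ε, hε, hP⟩ :=
    hkick e F hF hFdich hF𝓓 hFQ (by rwa [hF0])
  exact ⟨e', F', hF', himm, hF'0.trans hF0, hinj, hF'𝓓, ε, hε, hP⟩

end Composition

/-- **THE RE-TYPED SUMMIT FROM TAME CENSORSHIP, THE SHARED POINTWISE C⁰ TRIO AND THIRD-LAW KICKS.**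
Hypotheses, verbatim: `hW` the body of `PhaseMixingCapture.WeakCosmicCensorshipTame` (tame weak cosmic
censorship in MGHD form); `hA` item stmt-17296 (every censored MGHD carries an honest C⁰ final-state
decomposition, extremal endpoints allowed); `hU` item stmt-17298 (an honest C⁰ configuration with
sub-extremal holes upgrades to the summit's honest C² decomposition); `hR` the line's `stub_thirdLawKick`
(along every tame admissible curve of censored data whose base is not censored-∧-third-law, a tame
injective immersed admissible curve through the base whose small members are censored and third-law).
Proof: tame-generic censorship ⟹ tame-generic (censored ∧ third law) by
`isTameChristodoulouGeneric_of_relativeKick`; then pointwise `hA`, `hU` give the summit's matrix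
(`IsTameChristodoulouGeneric.mono`). [folklore] -/
theorem finalStateConjecture_of_thirdLawKick :
    (∀ (X : Type) [TopologicalSpace X] [ChartedSpace E3 X] [IsManifold (𝓡 3) ∞ X] [T2Space X]
      [SecondCountableTopology X] [ConnectedSpace X],
      InitialDataSet.IsTameChristodoulouGeneric (admissibleVacuumData X)
        (fun D ↦ (∃ 𝒟 : VacuumCauchyDevelopment D, 𝒟.IsMaximal) ∧
          ∀ 𝒟 : VacuumCauchyDevelopment D, 𝒟.IsMaximal →
            HasCompleteNullInfinity 𝒟.toCauchyDevelopment) 1) →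
    (∀ (X : Type) [TopologicalSpace X] [ChartedSpace E3 X] [IsManifold (𝓡 3) ∞ X] [T2Space X]
      [SecondCountableTopology X] [ConnectedSpace X],
      ∀ D ∈ admissibleVacuumData X, ∀ 𝒟 : VacuumCauchyDevelopment D, 𝒟.IsMaximal →
        HasCompleteNullInfinity 𝒟.toCauchyDevelopment →
          ∃ (O : Set 𝒟.carrier) (d : FinalStateDecomposition 𝒟.toSpacetime O 0),
            O = exteriorOf 𝒟.toCauchyDevelopment d.charted ∧ RaysStayInClosure 𝒟.toCauchyDevelopment O ∧
              HasExhaustiveCharts d ∧ IsFutureOriented d) →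
    (∀ (X : Type) [TopologicalSpace X] [ChartedSpace E3 X] [IsManifold (𝓡 3) ∞ X] [T2Space X]
      [SecondCountableTopology X] [ConnectedSpace X],
      ∀ D ∈ admissibleVacuumData X, ∀ 𝒟 : VacuumCauchyDevelopment D, 𝒟.IsMaximal →
        HasCompleteNullInfinity 𝒟.toCauchyDevelopment →
          ∀ (O : Set 𝒟.carrier) (d₀ : FinalStateDecomposition 𝒟.toSpacetime O 0),
            O = exteriorOf 𝒟.toCauchyDevelopment d₀.charted → RaysStayInClosure 𝒟.toCauchyDevelopment O →
              HasExhaustiveCharts d₀ → IsFutureOriented d₀ →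
                (∀ i, Kerr.IsSubextremal (d₀.mass i) (d₀.spin i)) →
                  ∃ (O' : Set 𝒟.carrier) (d : FinalStateDecomposition 𝒟.toSpacetime O' 2),
                    (∀ i, Kerr.IsSubextremal (d.mass i) (d.spin i)) ∧
                      O' = exteriorOf 𝒟.toCauchyDevelopment d.charted ∧
                        RaysStayInClosure 𝒟.toCauchyDevelopment O' ∧ HasExhaustiveCharts d ∧
                          IsFutureOriented d) →
    (∀ (X : Type) [TopologicalSpace X] [ChartedSpace E3 X] [IsManifold (𝓡 3) ∞ X] [T2Space X]
      [SecondCountableTopology X] [ConnectedSpace X],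
      ∀ (e : AFEnd X) (F : EuclideanSpace ℝ (Fin 1) → InitialDataSet (𝓡 3) X),
        InitialDataSet.IsTameDataFamily e 1 F →
          ((InitialDataSet.IsImmersedAtZero 1 F ∧ Function.Injective F) ∨ ∀ c, F c = F 0) →
          (∀ c, F c ∈ admissibleVacuumData X) →
          (∀ c ≠ 0, (∃ 𝒟 : VacuumCauchyDevelopment (F c), 𝒟.IsMaximal) ∧
              ∀ 𝒟 : VacuumCauchyDevelopment (F c), 𝒟.IsMaximal →
                HasCompleteNullInfinity 𝒟.toCauchyDevelopment) →
          ¬ (((∃ 𝒟 : VacuumCauchyDevelopment (F 0), 𝒟.IsMaximal) ∧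
                ∀ 𝒟 : VacuumCauchyDevelopment (F 0), 𝒟.IsMaximal →
                  HasCompleteNullInfinity 𝒟.toCauchyDevelopment) ∧
              ∀ 𝒟 : VacuumCauchyDevelopment (F 0), 𝒟.IsMaximal →
                HasCompleteNullInfinity 𝒟.toCauchyDevelopment ∧
                  ∀ (O : Set 𝒟.carrier) (d : FinalStateDecomposition 𝒟.toSpacetime O 0),
                    O = exteriorOf 𝒟.toCauchyDevelopment d.charted →
                      RaysStayInClosure 𝒟.toCauchyDevelopment O → HasExhaustiveCharts d →
                        IsFutureOriented d → ∀ i, Kerr.IsSubextremal (d.mass i) (d.spin i)) →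
          ∃ (e' : AFEnd X) (F' : EuclideanSpace ℝ (Fin 1) → InitialDataSet (𝓡 3) X),
            InitialDataSet.IsTameDataFamily e' 1 F' ∧ F' 0 = F 0 ∧ Function.Injective F' ∧
              InitialDataSet.IsImmersedAtZero 1 F' ∧ (∀ c, F' c ∈ admissibleVacuumData X) ∧
              ∃ ε₀ > (0 : ℝ), ∀ c : EuclideanSpace ℝ (Fin 1), c ≠ 0 → ‖c‖ < ε₀ →
                ((∃ 𝒟 : VacuumCauchyDevelopment (F' c), 𝒟.IsMaximal) ∧
                    ∀ 𝒟 : VacuumCauchyDevelopment (F' c), 𝒟.IsMaximal →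
                      HasCompleteNullInfinity 𝒟.toCauchyDevelopment) ∧
                  ∀ 𝒟 : VacuumCauchyDevelopment (F' c), 𝒟.IsMaximal →
                    HasCompleteNullInfinity 𝒟.toCauchyDevelopment ∧
                      ∀ (O : Set 𝒟.carrier) (d : FinalStateDecomposition 𝒟.toSpacetime O 0),
                        O = exteriorOf 𝒟.toCauchyDevelopment d.charted →
                          RaysStayInClosure 𝒟.toCauchyDevelopment O → HasExhaustiveCharts d →
                            IsFutureOriented d → ∀ i, Kerr.IsSubextremal (d.mass i) (d.spin i)) →
    _root_.FinalStateConjecture := by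
  intro hW hA hU hR X _ _ _ _ _ _
  have h𝓓 : ∀ d ∈ admissibleVacuumData X,
      ∃ e : AFEnd X, e.IsSoleEnd ∧ ∃ M : ℝ, e.IsStronglyAsymptoticallyFlatDR d M :=
    fun d hd ↦ exists_isSoleEnd_of_mem_admissibleVacuumData hd
  -- tame-generic (censored ∧ third law), by the kick composition along censored curves
  have gT : InitialDataSet.IsTameChristodoulouGeneric (admissibleVacuumData X)
      (fun D ↦ ((∃ 𝒟 : VacuumCauchyDevelopment D, 𝒟.IsMaximal) ∧
          ∀ 𝒟 : VacuumCauchyDevelopment D, 𝒟.IsMaximal →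
            HasCompleteNullInfinity 𝒟.toCauchyDevelopment) ∧
        ∀ 𝒟 : VacuumCauchyDevelopment D, 𝒟.IsMaximal →
          HasCompleteNullInfinity 𝒟.toCauchyDevelopment ∧
            ∀ (O : Set 𝒟.carrier) (d : FinalStateDecomposition 𝒟.toSpacetime O 0),
              O = exteriorOf 𝒟.toCauchyDevelopment d.charted →
                RaysStayInClosure 𝒟.toCauchyDevelopment O → HasExhaustiveCharts d →
                  IsFutureOriented d → ∀ i, Kerr.IsSubextremal (d.mass i) (d.spin i)) 1 :=
    isTameChristodoulouGeneric_of_relativeKick h𝓓 (hW X) (hR X)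
  -- pointwise upgrade to the summit's matrix by (A) and (U)
  refine gT.mono fun D hD hDT ↦ ⟨hDT.1.1, fun 𝒟 hmax ↦ ⟨hDT.1.2 𝒟 hmax, ?_⟩⟩
  obtain ⟨O, d, hO, hRay, hExh, hFut⟩ := hA X D hD 𝒟 hmax (hDT.1.2 𝒟 hmax)
  exact hU X D hD 𝒟 hmax (hDT.1.2 𝒟 hmax) O d hO hRay hExh hFut
    ((hDT.2 𝒟 hmax).2 O d hO hRay hExh hFut)


/-- **v2 (∃-form): THE RE-TYPED SUMMIT FROM TAME CENSORSHIP, THE SHARED POINTWISE C⁰ TRIO AND UN-PARKING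
KICKS.** As `finalStateConjecture_of_thirdLawKick`, with the kick's matrix WEAKENED from the ∀-form of item
stmt-17297 ("every honest C⁰ endpoint configuration of every MGHD has sub-extremal labels") to its ∃-form
UN-PARKED ("every MGHD has complete `𝓘⁺` and, whenever it carries some honest C⁰ endpoint configuration,
carries one with sub-extremal labels") — the line's registered `stub_unparkingKick` (skeleton v2). Reason: at
`k = 0` nothing pins the labels `(N, Mᵢ, aᵢ)` of an honest decomposition to the spacetime (at `k = 2` curvature
invariants do), so the ∀-form may fail on an open set of black-hole data for a reason foreign to the third law
(parasitic honest C⁰ decompositions with an extremal label — a Lorentzian C⁰-rigidity question); the ∃-form is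
immune and the composition is unchanged: censored ∧ un-parked ⟹ stub A gives an honest C⁰ configuration,
un-parked makes one sub-extremal, stub U upgrades it. The ∀-form implies the ∃-form. [folklore] -/
theorem finalStateConjecture_of_unparkingKick :
    (∀ (X : Type) [TopologicalSpace X] [ChartedSpace E3 X] [IsManifold (𝓡 3) ∞ X] [T2Space X]
      [SecondCountableTopology X] [ConnectedSpace X],
      InitialDataSet.IsTameChristodoulouGeneric (admissibleVacuumData X)
        (fun D ↦ (∃ 𝒟 : VacuumCauchyDevelopment D, 𝒟.IsMaximal) ∧
          ∀ 𝒟 : VacuumCauchyDevelopment D, 𝒟.IsMaximal →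
            HasCompleteNullInfinity 𝒟.toCauchyDevelopment) 1) →
    (∀ (X : Type) [TopologicalSpace X] [ChartedSpace E3 X] [IsManifold (𝓡 3) ∞ X] [T2Space X]
      [SecondCountableTopology X] [ConnectedSpace X],
      ∀ D ∈ admissibleVacuumData X, ∀ 𝒟 : VacuumCauchyDevelopment D, 𝒟.IsMaximal →
        HasCompleteNullInfinity 𝒟.toCauchyDevelopment →
          ∃ (O : Set 𝒟.carrier) (d : FinalStateDecomposition 𝒟.toSpacetime O 0),
            O = exteriorOf 𝒟.toCauchyDevelopment d.charted ∧ RaysStayInClosure 𝒟.toCauchyDevelopment O ∧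
              HasExhaustiveCharts d ∧ IsFutureOriented d) →
    (∀ (X : Type) [TopologicalSpace X] [ChartedSpace E3 X] [IsManifold (𝓡 3) ∞ X] [T2Space X]
      [SecondCountableTopology X] [ConnectedSpace X],
      ∀ D ∈ admissibleVacuumData X, ∀ 𝒟 : VacuumCauchyDevelopment D, 𝒟.IsMaximal →
        HasCompleteNullInfinity 𝒟.toCauchyDevelopment →
          ∀ (O : Set 𝒟.carrier) (d₀ : FinalStateDecomposition 𝒟.toSpacetime O 0),
            O = exteriorOf 𝒟.toCauchyDevelopment d₀.charted → RaysStayInClosure 𝒟.toCauchyDevelopment O →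
              HasExhaustiveCharts d₀ → IsFutureOriented d₀ →
                (∀ i, Kerr.IsSubextremal (d₀.mass i) (d₀.spin i)) →
                  ∃ (O' : Set 𝒟.carrier) (d : FinalStateDecomposition 𝒟.toSpacetime O' 2),
                    (∀ i, Kerr.IsSubextremal (d.mass i) (d.spin i)) ∧
                      O' = exteriorOf 𝒟.toCauchyDevelopment d.charted ∧
                        RaysStayInClosure 𝒟.toCauchyDevelopment O' ∧ HasExhaustiveCharts d ∧
                          IsFutureOriented d) →
    (∀ (X : Type) [TopologicalSpace X] [ChartedSpace E3 X] [IsManifold (𝓡 3) ∞ X] [T2Space X]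
      [SecondCountableTopology X] [ConnectedSpace X],
      ∀ (e : AFEnd X) (F : EuclideanSpace ℝ (Fin 1) → InitialDataSet (𝓡 3) X),
        InitialDataSet.IsTameDataFamily e 1 F →
          ((InitialDataSet.IsImmersedAtZero 1 F ∧ Function.Injective F) ∨ ∀ c, F c = F 0) →
          (∀ c, F c ∈ admissibleVacuumData X) →
          (∀ c ≠ 0, (∃ 𝒟 : VacuumCauchyDevelopment (F c), 𝒟.IsMaximal) ∧
              ∀ 𝒟 : VacuumCauchyDevelopment (F c), 𝒟.IsMaximal →
                HasCompleteNullInfinity 𝒟.toCauchyDevelopment) →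
          ¬ (((∃ 𝒟 : VacuumCauchyDevelopment (F 0), 𝒟.IsMaximal) ∧
                    ∀ 𝒟 : VacuumCauchyDevelopment (F 0), 𝒟.IsMaximal →
                      HasCompleteNullInfinity 𝒟.toCauchyDevelopment) ∧
                  ∀ 𝒟 : VacuumCauchyDevelopment (F 0), 𝒟.IsMaximal →
                    HasCompleteNullInfinity 𝒟.toCauchyDevelopment ∧
                      ((∃ (O : Set 𝒟.carrier) (d₀ : FinalStateDecomposition 𝒟.toSpacetime O 0),
                          O = exteriorOf 𝒟.toCauchyDevelopment d₀.charted ∧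
                            RaysStayInClosure 𝒟.toCauchyDevelopment O ∧ HasExhaustiveCharts d₀ ∧
                              IsFutureOriented d₀) →
                        ∃ (O : Set 𝒟.carrier) (d : FinalStateDecomposition 𝒟.toSpacetime O 0),
                          (∀ i, Kerr.IsSubextremal (d.mass i) (d.spin i)) ∧
                            O = exteriorOf 𝒟.toCauchyDevelopment d.charted ∧
                              RaysStayInClosure 𝒟.toCauchyDevelopment O ∧ HasExhaustiveCharts d ∧
                                IsFutureOriented d)) →
          ∃ (e' : AFEnd X) (F' : EuclideanSpace ℝ (Fin 1) → InitialDataSet (𝓡 3) X),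
            InitialDataSet.IsTameDataFamily e' 1 F' ∧ F' 0 = F 0 ∧ Function.Injective F' ∧
              InitialDataSet.IsImmersedAtZero 1 F' ∧ (∀ c, F' c ∈ admissibleVacuumData X) ∧
              ∃ ε₀ > (0 : ℝ), ∀ c : EuclideanSpace ℝ (Fin 1), c ≠ 0 → ‖c‖ < ε₀ →
                (((∃ 𝒟 : VacuumCauchyDevelopment (F' c), 𝒟.IsMaximal) ∧
                    ∀ 𝒟 : VacuumCauchyDevelopment (F' c), 𝒟.IsMaximal →
                      HasCompleteNullInfinity 𝒟.toCauchyDevelopment) ∧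
                  ∀ 𝒟 : VacuumCauchyDevelopment (F' c), 𝒟.IsMaximal →
                    HasCompleteNullInfinity 𝒟.toCauchyDevelopment ∧
                      ((∃ (O : Set 𝒟.carrier) (d₀ : FinalStateDecomposition 𝒟.toSpacetime O 0),
                          O = exteriorOf 𝒟.toCauchyDevelopment d₀.charted ∧
                            RaysStayInClosure 𝒟.toCauchyDevelopment O ∧ HasExhaustiveCharts d₀ ∧
                              IsFutureOriented d₀) →
                        ∃ (O : Set 𝒟.carrier) (d : FinalStateDecomposition 𝒟.toSpacetime O 0),
                          (∀ i, Kerr.IsSubextremal (d.mass i) (d.spin i)) ∧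
                            O = exteriorOf 𝒟.toCauchyDevelopment d.charted ∧
                              RaysStayInClosure 𝒟.toCauchyDevelopment O ∧ HasExhaustiveCharts d ∧
                                IsFutureOriented d))) →
    _root_.FinalStateConjecture := by
  intro hW hA hU hR X _ _ _ _ _ _
  have h𝓓 : ∀ d ∈ admissibleVacuumData X,
      ∃ e : AFEnd X, e.IsSoleEnd ∧ ∃ M : ℝ, e.IsStronglyAsymptoticallyFlatDR d M :=
    fun d hd ↦ exists_isSoleEnd_of_mem_admissibleVacuumData hd
  -- tame-generic (censored ∧ un-parked), by the kick composition along censored curves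
  have gT : InitialDataSet.IsTameChristodoulouGeneric (admissibleVacuumData X)
      (fun D ↦ ((∃ 𝒟 : VacuumCauchyDevelopment D, 𝒟.IsMaximal) ∧
          ∀ 𝒟 : VacuumCauchyDevelopment D, 𝒟.IsMaximal →
            HasCompleteNullInfinity 𝒟.toCauchyDevelopment) ∧
        ∀ 𝒟 : VacuumCauchyDevelopment D, 𝒟.IsMaximal →
          HasCompleteNullInfinity 𝒟.toCauchyDevelopment ∧
            ((∃ (O : Set 𝒟.carrier) (d₀ : FinalStateDecomposition 𝒟.toSpacetime O 0),
                O = exteriorOf 𝒟.toCauchyDevelopment d₀.charted ∧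
                  RaysStayInClosure 𝒟.toCauchyDevelopment O ∧ HasExhaustiveCharts d₀ ∧
                    IsFutureOriented d₀) →
              ∃ (O : Set 𝒟.carrier) (d : FinalStateDecomposition 𝒟.toSpacetime O 0),
                (∀ i, Kerr.IsSubextremal (d.mass i) (d.spin i)) ∧
                  O = exteriorOf 𝒟.toCauchyDevelopment d.charted ∧
                    RaysStayInClosure 𝒟.toCauchyDevelopment O ∧ HasExhaustiveCharts d ∧
                      IsFutureOriented d)) 1 :=
    isTameChristodoulouGeneric_of_relativeKick h𝓓 (hW X) (hR X)
  -- pointwise upgrade to the summit's matrix by (A), un-parked, (U)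
  refine gT.mono fun D hD hDT ↦ ⟨hDT.1.1, fun 𝒟 hmax ↦ ⟨hDT.1.2 𝒟 hmax, ?_⟩⟩
  obtain ⟨O, d, hsub, hO, hRay, hExh, hFut⟩ :=
    ((hDT.2 𝒟 hmax).2 (hA X D hD 𝒟 hmax (hDT.1.2 𝒟 hmax)))
  exact hU X D hD 𝒟 hmax (hDT.1.2 𝒟 hmax) O d hO hRay hExh hFut hsub

end Summit.FinalStateConjecture.FinalStateConjecture.Theorems.PhaseMixingCaptureCaptureSufficesTame

end
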